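import Summits.KontsevichZagierPeriods.KontsevichZagierPeriods.Theorems.FiveTermTransfer.Negative.Reduction

/-!
# `FiveTermTransfer` (stmt-KontsevichZagierPeriods-3469) — part 5: the inversion move and the final reduction

`[T(x), t⁻³] − [T(1/x̄), t⁻³]` is ONE change-of-variables generator of the KZ calculus: inversion in
the unit sphere `p ↦ p/|p|²` (`ℚ`-rational, `|det| = |p|⁻⁶`, `t⁻³ = (t/|p|²)⁻³ · |p|⁻⁶`; it maps
`T(x)` onto `T(1/x̄)`, exchanging the roles of the edge `1x` and the hemisphere). Consequences for
the crux: the instance `y = 1` holds for every standard family (`fiveTerm_one_right_mem_relations`),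
so `y ≠ 1` is removable, and `fiveTermTransfer_iff_ρ₀'`: the crux ⇔ its `ρ₀`-instance with ONLY
`x ≠ 0`, `y ≠ 0`. Also a complete worked instance of the plumbing route item IsometryMove
(stmt-3471) needs (semialgebraic map, `HasFDerivAt`, determinant via `Matrix.det_fin_three`,
injectivity, image). (cdisprove seat gen 2; re-derivation of gen 1's evidence `Inversion.lean`.) [folklore]
-/

noncomputable section

open Complex MeasureTheory Set
open scoped ComplexConjugate

namespace Summit.KontsevichZagierPeriods.HyperbolicBloch.FiveTermTransferNegative

open Literature.NumberTheory.Transcendental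
open Literature.NumberTheory.Transcendental.KZ
open Literature.ModelTheory.ExponentialFields (IsSemialgebraic)
open MvPolynomial (aeval X)
open Summit.KontsevichZagierPeriods.KontsevichZagierPeriods.Theses.HyperbolicBloch (FiveTermTransfer)

/-! ## §5 The inversion move (positive by-product) and the final reduction

`[T(x), t⁻³] − [T(1/x̄), t⁻³]` is ONE change-of-variables generator: inversion in the unit sphere
`p ↦ p/|p|²` (a `ℚ`-rational map, `|det| = |p|⁻⁶`, `t⁻³ = (t/|p|²)⁻³·|p|⁻⁶`, and `T(x) ↦ T(1/x̄)`
with the roles of the edge `1x` and the hemisphere exchanged). Consequences: the instance `y = 1`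
of the crux holds for every standard family (`fiveTerm_one_right_mem_relations`), so `y ≠ 1` is
removable too, and the crux is equivalent to its `ρ₀`-instance with ONLY `x ≠ 0`, `y ≠ 0`
(`fiveTermTransfer_iff_ρ₀'`). This section is also a complete worked instance of route item
IsometryMove (stmt-3471) inside the calculus (semialgebraicity, derivative, determinant via
`Matrix.det_fin_three`, injectivity, image). -/

/-- Squared Euclidean norm on `ℝ³`. -/
def sqn (p : Fin 3 → ℝ) : ℝ := p 0 ^ 2 + p 1 ^ 2 + p 2 ^ 2

/-- Auxiliary: `sqn_pos`. [folklore] -/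
theorem sqn_pos {p : Fin 3 → ℝ} (hp : 0 < p 2) : 0 < sqn p := by
  unfold sqn; nlinarith [sq_nonneg (p 0), sq_nonneg (p 1), mul_pos hp hp]

/-- Inversion in the unit sphere of `ℝ³`. -/
def inv3 (p : Fin 3 → ℝ) : Fin 3 → ℝ := (sqn p)⁻¹ • p

/-- Auxiliary: `inv3_apply`. [folklore] -/
theorem inv3_apply (p : Fin 3 → ℝ) (i : Fin 3) : inv3 p i = p i / sqn p := by
  simp [inv3, div_eq_inv_mul]

/-- Auxiliary: `sqn_inv3`. [folklore] -/
theorem sqn_inv3 {p : Fin 3 → ℝ} (h : sqn p ≠ 0) : sqn (inv3 p) = (sqn p)⁻¹ := by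
  have e : sqn (inv3 p) = sqn p / (sqn p) ^ 2 := by
    simp only [sqn, inv3_apply]
    field_simp
  rw [e, pow_two, div_mul_eq_div_div, div_self h, one_div]

/-- Auxiliary: `inv3_inv3`. [folklore] -/
theorem inv3_inv3 {p : Fin 3 → ℝ} (h : sqn p ≠ 0) : inv3 (inv3 p) = p := by
  ext i
  rw [inv3_apply, sqn_inv3 h, inv3_apply]
  field_simp

/-- Auxiliary: `injOn_inv3`. [folklore] -/
theorem injOn_inv3 {σ : Set (Fin 3 → ℝ)} (hσ : ∀ p ∈ σ, sqn p ≠ 0) : InjOn inv3 σ :=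
  fun p hp q hq e => by rw [← inv3_inv3 (hσ p hp), e, inv3_inv3 (hσ q hq)]

/-- The derivative of `sqn`. -/
def sqn' (p : Fin 3 → ℝ) : (Fin 3 → ℝ) →L[ℝ] ℝ :=
  ((2 : ℕ) • p 0 ^ (2 - 1)) • ContinuousLinearMap.proj (R := ℝ) (φ := fun _ : Fin 3 => ℝ) 0 +
    ((2 : ℕ) • p 1 ^ (2 - 1)) • ContinuousLinearMap.proj (R := ℝ) (φ := fun _ : Fin 3 => ℝ) 1 +
    ((2 : ℕ) • p 2 ^ (2 - 1)) • ContinuousLinearMap.proj (R := ℝ) (φ := fun _ : Fin 3 => ℝ) 2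

/-- Auxiliary: `sqn'_apply`. [folklore] -/
theorem sqn'_apply (p v : Fin 3 → ℝ) :
    sqn' p v = 2 * p 0 * v 0 + 2 * p 1 * v 1 + 2 * p 2 * v 2 := by
  simp [sqn']

/-- Auxiliary: `hasFDerivAt_sqn`. [folklore] -/
theorem hasFDerivAt_sqn (p : Fin 3 → ℝ) : HasFDerivAt sqn (sqn' p) p := by
  unfold sqn sqn'
  exact (((hasFDerivAt_apply (𝕜 := ℝ) (0 : Fin 3) p).pow 2).add
    ((hasFDerivAt_apply (𝕜 := ℝ) (1 : Fin 3) p).pow 2)).add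
    ((hasFDerivAt_apply (𝕜 := ℝ) (2 : Fin 3) p).pow 2)

/-- The derivative of `inv3` at `p` (for `sqn p ≠ 0`). -/
def inv3' (p : Fin 3 → ℝ) : (Fin 3 → ℝ) →L[ℝ] (Fin 3 → ℝ) :=
  (sqn p)⁻¹ • ContinuousLinearMap.id ℝ (Fin 3 → ℝ) +
    ((ContinuousLinearMap.toSpanSingleton ℝ (-(sqn p ^ 2)⁻¹)).comp (sqn' p)).smulRight p

/-- Auxiliary: `hasFDerivAt_inv3`. [folklore] -/
theorem hasFDerivAt_inv3 {p : Fin 3 → ℝ} (h : sqn p ≠ 0) : HasFDerivAt inv3 (inv3' p) p := by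
  have h1 : HasFDerivAt (fun q => (sqn q)⁻¹)
      ((ContinuousLinearMap.toSpanSingleton ℝ (-(sqn p ^ 2)⁻¹)).comp (sqn' p)) p :=
    (hasFDerivAt_inv h).comp p (hasFDerivAt_sqn p)
  have h2 := h1.smul (hasFDerivAt_id p)
  exact h2

/-- Auxiliary: `inv3'_apply`. [folklore] -/
theorem inv3'_apply (p v : Fin 3 → ℝ) (i : Fin 3) :
    inv3' p v i = (sqn p)⁻¹ * v i + (-(sqn p ^ 2)⁻¹ * (2 * p 0 * v 0 + 2 * p 1 * v 1 + 2 * p 2 * v 2)) * p i := by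
  have e : inv3' p v = (sqn p)⁻¹ • v + ((sqn' p v) • (-(sqn p ^ 2)⁻¹)) • p := rfl
  rw [e]
  simp only [Pi.add_apply, Pi.smul_apply, smul_eq_mul, sqn'_apply]
  ring

/-- The matrix of `inv3' p`. -/
def invMat (p : Fin 3 → ℝ) : Matrix (Fin 3) (Fin 3) ℝ :=
  fun i j => (if i = j then (sqn p)⁻¹ else 0) - 2 * (sqn p ^ 2)⁻¹ * p i * p j

/-- Auxiliary: `inv3'_eq_toLin`. [folklore] -/
theorem inv3'_eq_toLin (p : Fin 3 → ℝ) :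
    (inv3' p : (Fin 3 → ℝ) →ₗ[ℝ] (Fin 3 → ℝ)) = Matrix.toLin' (invMat p) := by
  apply LinearMap.ext
  intro v
  funext i
  rw [ContinuousLinearMap.coe_coe, inv3'_apply, Matrix.toLin'_apply]
  simp [Matrix.mulVec, dotProduct, Fin.sum_univ_three, invMat]
  fin_cases i <;> simp <;> ring

/-- Auxiliary: `det_inv3'`. [folklore] -/
theorem det_inv3' {p : Fin 3 → ℝ} (h : sqn p ≠ 0) : (inv3' p).det = -((sqn p)⁻¹ ^ 3) := by
  rw [ContinuousLinearMap.det, inv3'_eq_toLin, LinearMap.det_toLin', Matrix.det_fin_three]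
  simp [invMat]
  have hs : p 0 ^ 2 + p 1 ^ 2 + p 2 ^ 2 = sqn p := rfl
  field_simp
  rw [← hs]
  ring

/-- Auxiliary: `abs_det_inv3'`. [folklore] -/
theorem abs_det_inv3' {p : Fin 3 → ℝ} (h : 0 < sqn p) : |(inv3' p).det| = (sqn p)⁻¹ ^ 3 := by
  rw [det_inv3' h.ne', abs_neg, abs_of_pos (by positivity)]

/-! ### The ideal tetrahedron under inversion -/

/-- Auxiliary: `conj_inv_re`. [folklore] -/
theorem conj_inv_re (x : ℂ) : (conj x⁻¹).re = x.re / Complex.normSq x := by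
  simp [Complex.inv_re]

/-- Auxiliary: `conj_inv_im`. [folklore] -/
theorem conj_inv_im (x : ℂ) : (conj x⁻¹).im = x.im / Complex.normSq x := by
  simp [Complex.inv_im]

/-- Auxiliary: `normSq_conj_inv`. [folklore] -/
theorem normSq_conj_inv (x : ℂ) : Complex.normSq (conj x⁻¹) = (Complex.normSq x)⁻¹ := by
  simp

/-- Auxiliary: `conj_inv_im_pos`. [folklore] -/
theorem conj_inv_im_pos {x : ℂ} (him : 0 < x.im) : 0 < (conj x⁻¹).im := by
  rw [conj_inv_im]
  exact div_pos him (Complex.normSq_pos.mpr (by rintro rfl; simp at him))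

/-- Auxiliary: `conj_inv_conj_inv`. [folklore] -/
theorem conj_inv_conj_inv (x : ℂ) : conj (conj x⁻¹)⁻¹ = x := by simp

/-- Inversion maps `T(x)` into `T(1/x̄) = T(conj x⁻¹)`: the five defining inequalities are
exchanged (edge `0x` ↔ edge `0x'`, edge `1x` ↔ hemisphere, hemisphere ↔ edge `1x'`). -/
theorem inv3_mem {x : ℂ} (him : 0 < x.im) {p : Fin 3 → ℝ} (hp : p ∈ idealTetrahedron x) :
    inv3 p ∈ idealTetrahedron (conj x⁻¹) := by
  obtain ⟨h1, h2, h3, h4, h5⟩ := hp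
  have hs : 0 < sqn p := sqn_pos h4
  have hN : 0 < Complex.normSq x := Complex.normSq_pos.mpr (by rintro rfl; simp at him)
  have hNs : 0 < Complex.normSq x * sqn p := mul_pos hN hs
  rw [mem_idealTetrahedron_iff]
  simp only [inv3_apply]
  rw [conj_inv_re, conj_inv_im, normSq_conj_inv]
  set N := Complex.normSq x with hNdef
  set s := sqn p with hsdef
  have hs0 : s ≠ 0 := hs.ne'
  have hN0 : N ≠ 0 := hN.ne'
  have hsq : p 0 ^ 2 + p 1 ^ 2 + p 2 ^ 2 = s := rfl
  refine ⟨div_pos h1 hs, ?_, ?_, div_pos h4 hs, ?_⟩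
  · -- edge `0x`
    have e : x.im / N * (p 0 / s) - x.re / N * (p 1 / s) = (x.im * p 0 - x.re * p 1) / (N * s) := by
      field_simp
    have : 0 < x.im / N * (p 0 / s) - x.re / N * (p 1 / s) := by
      rw [e]; exact div_pos (by linarith) hNs
    linarith
  · -- edge `1x'` from the hemisphere of `T(x)`
    have e : (x.re / N - 1) * (p 1 / s) - x.im / N * (p 0 / s - 1) =
        (x.im * (s - p 0) + (x.re - N) * p 1) / (N * s) := by
      field_simp
      ring
    have h5' : 0 < x.im * (s - p 0) + (x.re - N) * p 1 := by rw [← hsq]; linarith [h5]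
    have : 0 < (x.re / N - 1) * (p 1 / s) - x.im / N * (p 0 / s - 1) := by
      rw [e]; exact div_pos h5' hNs
    linarith
  · -- hemisphere of `T(x')` from the edge `1x`
    have e : x.im / N * ((p 0 / s) ^ 2 + (p 1 / s) ^ 2 + (p 2 / s) ^ 2 - p 0 / s) +
        (x.re / N - N⁻¹) * (p 1 / s) = (x.im * (1 - p 0) + (x.re - 1) * p 1) / (N * s) := by
      have e2 : (p 0 / s) ^ 2 + (p 1 / s) ^ 2 + (p 2 / s) ^ 2 = 1 / s := by
        field_simp
        rw [← hsq]
      rw [e2]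
      field_simp
    rw [e]
    exact div_pos (by linarith) hNs

/-- The image of `T(x)` under inversion is `T(1/x̄)`. -/
theorem image_inv3 {x : ℂ} (him : 0 < x.im) :
    inv3 '' idealTetrahedron x = idealTetrahedron (conj x⁻¹) := by
  apply Subset.antisymm
  · rintro _ ⟨p, hp, rfl⟩
    exact inv3_mem him hp
  · intro q hq
    refine ⟨inv3 q, ?_, inv3_inv3 (sqn_pos (pos_of_mem_idealTetrahedron hq)).ne'⟩
    have h := inv3_mem (conj_inv_im_pos him) hq
    rwa [conj_inv_conj_inv] at h

/-- Inversion is a `ℚ`-semialgebraic map on every `ℚ`-semialgebraic subset of `{p 2 > 0}`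
(coordinates `Xᵢ / (X₀² + X₁² + X₂²)`). -/
theorem isSemialgebraicMapOn_inv3 {σ : Set (Fin 3 → ℝ)} (hσ : IsSemialgebraic ℚ σ)
    (h : σ ⊆ {p | 0 < p 2}) : IsSemialgebraicMapOn ℚ σ inv3 := by
  refine IsSemialgebraicMapOn.of_forall hσ fun j => ?_
  have hq : ∀ p ∈ σ, aeval p (X 0 ^ 2 + X 1 ^ 2 + X 2 ^ 2 : MvPolynomial (Fin 3) ℚ) ≠ 0 := by
    intro p hp
    have := (sqn_pos (h hp)).ne'
    simpa [sqn] using this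
  refine (isSemialgebraicFunOn_aeval_div_aeval hσ (X j) (X 0 ^ 2 + X 1 ^ 2 + X 2 ^ 2) hq).congr ?_
  intro p _
  simp [inv3_apply, sqn]

/-- **The inversion move.** For algebraic `x` in the upper half plane, the standard representations
on `T(x)` and on `T(1/x̄)` differ by ONE change-of-variables generator (inversion in the unit
sphere, `|det| = |p|⁻⁶`, `t⁻³ = (t/|p|²)⁻³ · |p|⁻⁶`). -/
theorem inversion_mem_changeOfVariablesRel {x : ℂ} (hx : IsAlgebraic ℚ x) (him : 0 < x.im)
    (hx' : IsAlgebraic ℚ (conj x⁻¹)) (him' : 0 < (conj x⁻¹).im) :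
    KZ.of (idealTetrahedronRep x hx him) - KZ.of (idealTetrahedronRep (conj x⁻¹) hx' him') ∈
      changeOfVariablesRel := by
  refine ⟨3, idealTetrahedronRep x hx him, idealTetrahedronRep (conj x⁻¹) hx' him', inv3, inv3',
    ?_, ?_, ?_, ?_, ?_, rfl⟩
  · exact isSemialgebraicMapOn_inv3 (idealTetrahedronRep x hx him).isSemialgebraic_domain
      fun p hp => pos_of_mem_idealTetrahedron hp
  · intro p hp
    exact (hasFDerivAt_inv3 (sqn_pos (pos_of_mem_idealTetrahedron hp)).ne').hasFDerivWithinAt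
  · exact injOn_inv3 fun p hp => (sqn_pos (pos_of_mem_idealTetrahedron hp)).ne'
  · exact (image_inv3 him).symm
  · intro p hp
    have hs : 0 < sqn p := sqn_pos (pos_of_mem_idealTetrahedron hp)
    have ht : 0 < p 2 := pos_of_mem_idealTetrahedron hp
    simp only [integrand_idealTetrahedronRep, inv3_apply, abs_det_inv3' hs]
    field_simp

/-- Auxiliary: `isAlgebraic_conj_inv`. [folklore] -/
theorem isAlgebraic_conj_inv {x : ℂ} (hx : IsAlgebraic ℚ x) : IsAlgebraic ℚ (conj x⁻¹) := by
  simpa using hx.inv.algHom (starRingEnd ℂ).toRatAlgHom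

/-- The inversion relation `[T(x)] − [T(1/x̄)] ∈ KZ.relations`. -/
theorem inversion_mem_relations {x : ℂ} (hx : IsAlgebraic ℚ x) (him : 0 < x.im) :
    KZ.of (idealTetrahedronRep x hx him) -
      KZ.of (idealTetrahedronRep (conj x⁻¹) (isAlgebraic_conj_inv hx) (conj_inv_im_pos him)) ∈
      relations :=
  changeOfVariablesRel_subset_relations (inversion_mem_changeOfVariablesRel hx him _ _)


/-- **The instance `y = 1` holds** for every standard family and every algebraic `x`:
`B x + B x⁻¹ ∈ KZ.relations` (inversion move, conjugated to the upper half plane). [folklore] -/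
theorem fiveTerm_one_right_mem_relations {ρ : ℂ → IntegralRep 3} (hρ : IsStandardOn ρ) {x : ℂ}
    (hx : IsAlgebraic ℚ x) : fiveTerm (signedClass ρ) x 1 ∈ relations := by
  -- the upper-half-plane case, for any `w`
  have upper : ∀ {w : ℂ}, IsAlgebraic ℚ w → 0 < w.im →
      KZ.of (ρ w) - KZ.of (ρ (conj w⁻¹)) ∈ relations := by
    intro w hw hwi
    have hw' : IsAlgebraic ℚ (conj w⁻¹) := isAlgebraic_conj_inv hw
    have hwi' : 0 < (conj w⁻¹).im := conj_inv_im_pos hwi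
    have a := of_sub_of_mem_relations_of_isStandardOn hρ isStandardOn_ρ₀ hw hwi
    have b := inversion_mem_relations hw hwi
    have c := of_sub_of_mem_relations_of_isStandardOn isStandardOn_ρ₀ hρ hw' hwi'
    rw [show ρ₀ w = idealTetrahedronRep w hw hwi from stdRep_of_pos _ hw hwi] at a
    rw [show ρ₀ (conj w⁻¹) = idealTetrahedronRep (conj w⁻¹) hw' hwi' from
      stdRep_of_pos _ hw' hwi'] at c
    have e : KZ.of (ρ w) - KZ.of (ρ (conj w⁻¹)) = (KZ.of (ρ w) - KZ.of (idealTetrahedronRep w hw hwi))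
        + (KZ.of (idealTetrahedronRep w hw hwi)
            - KZ.of (idealTetrahedronRep (conj w⁻¹) hw' hwi'))
        + (KZ.of (idealTetrahedronRep (conj w⁻¹) hw' hwi') - KZ.of (ρ (conj w⁻¹))) := by abel
    rw [e]
    exact add_mem (add_mem a b) c
  rcases lt_trichotomy x.im 0 with h | h | h
  · -- lower half plane: conjugate
    have hxi : (x⁻¹).im > 0 := by
      rw [Complex.inv_im]
      exact div_pos (neg_pos.mpr h) (Complex.normSq_pos.mpr (by rintro rfl; simp at h))
    rw [fiveTerm_one_right, signedClass_of_im_neg ρ h, signedClass_of_im_pos ρ hxi]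
    have hc : IsAlgebraic ℚ (conj x) := by simpa using hx.algHom (starRingEnd ℂ).toRatAlgHom
    have u := upper hc (by simpa using h)
    rw [show conj (conj x)⁻¹ = x⁻¹ by simp] at u
    have e : -KZ.of (ρ (conj x)) + KZ.of (ρ x⁻¹) = -(KZ.of (ρ (conj x)) - KZ.of (ρ x⁻¹)) := by abel
    rw [e]
    exact neg_mem u
  · -- real line
    have hxi : (x⁻¹).im = 0 := by simp [Complex.inv_im, h]
    rw [fiveTerm_one_right, signedClass_of_im_zero ρ h, signedClass_of_im_zero ρ hxi, add_zero]
    exact zero_mem _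
  · rw [fiveTerm_one_right_of_im_pos ρ h]
    exact upper hx h

/-- **Final reduction.** The crux is equivalent to its instance for the single standard family
`ρ₀` with ONLY the two essential side conditions `x ≠ 0`, `y ≠ 0` (which ARE load-bearing,
§2). [folklore] -/
theorem fiveTermTransfer_iff_ρ₀' :
    FiveTermTransfer ↔ ∀ x y : ℂ, IsAlgebraic ℚ x → IsAlgebraic ℚ y → x ≠ 0 → y ≠ 0 →
      fiveTerm (signedClass ρ₀) x y ∈ relations := by
  rw [fiveTermTransfer_iff_ρ₀]
  constructor
  · intro h x y hx hy hx0 hy0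
    rcases eq_or_ne y 1 with rfl | hy1
    · exact fiveTerm_one_right_mem_relations isStandardOn_ρ₀ hx
    · exact h x y hx hy hx0 hy0 hy1
  · intro h x y hx hy hx0 hy0 _
    exact h x y hx hy hx0 hy0


end Summit.KontsevichZagierPeriods.HyperbolicBloch.FiveTermTransferNegative
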